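import Mathlib
import HarnessLib
import Summits.AtomisticToContinuum.FouriersLaw.Theses.JunctionLocality

/-!
# Strategy census S3 (instance B) for crux `JunctionLocality.ConductanceLowerBound` (stmt-AtomisticToContinuum-11749) —
typed companions of `STRATEGY-CENSUS-s3-B.md` (crux-strategist seat `cstrat-stmt-AtomisticToContinuum-11749-s3`, 2026-08-17)

Third strategist pass (generation 3).  Nothing here is a line: no `stub_*`, no composition to the crux
is registered, the live skeleton `Lines/abel_floor_exchange.lean` (lead c7) is untouched.  This file
PROVES the elementary computations that carry the new census entries, so that the census quotes
kernel-checked facts and not prose: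

* §1 (entries B-S3 / B-D2 — the frequency Harnack no-go).  For the
  infinite-volume Abel function `Â(ν) = ∫ ν/(ν²+ω²) dσ(ω)` of ANY positive measure `σ` (the Herglotz /
  Poisson form of the bulk Green–Kubo Abel means under the unitary Koopman group) the two-sided scale
  inequality `s·Â(ν) ≤ Â(sν) ≤ s⁻¹·Â(ν)` (`0 < s ≤ 1`) holds and is SHARP on Dirac masses: a floor at
  one frequency propagates to `ν → 0` only with the full geometric loss `2^{-k}`; frequency doubling
  carries no information beyond Herglotz monotonicity (`abelKernel_scale_ge/le`, `abelKernel_half_ratio`,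
  `abelMean_scale_ge`).
* §2 (Decomposition B-D1, matched-scale estimate).  The weight kernel `x ↦ x/(ν²+x)` is monotone, so a
  spectral-weight floor above the diffusive frequency `η k²` gives the Kubo function a floor
  `η²k⁴/(ν²+η²k⁴)`, equal to `1/2` exactly on the diagonal `ν = ηk²` (`weightKernel_mono`,
  `weightKernel_diag`) — the computation behind "floor on the diagonal, crux on the axis".
* §3 (Strengthen B-S1, the positive-autocorrelation engine).  If an autocorrelation `C ≥ 0` on `(0,∞)` has
  a short-time floor `C ≥ c₀` on `(0,t₀]`, every Abel mean is `≥ c₀ t₀ e^{-ν t₀}` — the trivial engine that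
  a sign principle would unlock (`abelMean_ge_of_nonneg_of_floor`).
* §4 (Negation B-N1, Boltzmann beats sub-quartic lifetimes).  `A ↦ exp(c A² − a A⁴)` is integrable for
  `a > 0`: a Gibbs weight `e^{-lam A⁴/(4T)}` kills any blocker lifetime `e^{cA²}` in mean, so rare
  long-lived breathers in series give finite mean resistance per site (`integrable_exp_sq_sub_quartic`).
* §5 (Strengthen B-S2, exact temperature–anharmonicity scaling, AGAINST THE TREE'S DEFINITIONS).
  `H_{ω₂,lam,β}(√T·x) = T · H_{ω₂,lamT,βT}(x)` for the actual `pinnedChain` Hamiltonian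
  (`hamiltonian_pinnedChain_scaling`): the algebraic core of `D_N(T; ω₂,lam,β,γ) = D_N(1; ω₂,lamT,βT,γ)`,
  which turns the heuristic two-ended divergence of `κ(T)` into NON-monotonicity of `D_N` in `(lam, β)`.
-/

noncomputable section

open MeasureTheory Set Real
open scoped ENNReal BigOperators

namespace Summit.AtomisticToContinuum.FouriersLaw.Cruxes.ConductanceLowerBound.StrategistS3B

/-! ## §1 Frequency Harnack for Poisson-type Abel kernels -/

/-- The Abel (Poisson) kernel `ν/(ν² + ω²)`: `Â(ν) = ∫ abelKernel ν ω dσ(ω)` for the spectral measure `σ`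
of the total current under a unitary (Hamiltonian, infinite-volume) evolution. [folklore] -/
def abelKernel (ν ω : ℝ) : ℝ := ν / (ν ^ 2 + ω ^ 2)

theorem abelKernel_nonneg {ν : ℝ} (hν : 0 ≤ ν) (ω : ℝ) : 0 ≤ abelKernel ν ω := by
  unfold abelKernel; positivity

/-- Lower scale inequality: `s · K(ν,ω) ≤ K(sν, ω)` for `0 < s ≤ 1` (i.e. `ν ↦ Â(ν)/ν` is non-increasing). -/
theorem abelKernel_scale_ge {s ν : ℝ} (hs : 0 < s) (hs1 : s ≤ 1) (hν : 0 < ν) (ω : ℝ) :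
    s * abelKernel ν ω ≤ abelKernel (s * ν) ω := by
  unfold abelKernel
  have h1 : 0 < ν ^ 2 + ω ^ 2 := by positivity
  have h2 : 0 < (s * ν) ^ 2 + ω ^ 2 := by positivity
  rw [mul_div_assoc', div_le_div_iff₀ h1 h2]
  have hs2 : s ^ 2 ≤ 1 := by nlinarith
  have : s * ν * ((s * ν) ^ 2 + ω ^ 2) ≤ s * ν * (ν ^ 2 + ω ^ 2) := by
    apply mul_le_mul_of_nonneg_left _ (by positivity)
    nlinarith [sq_nonneg ν, sq_nonneg ω]
  linarith

/-- Upper scale inequality: `K(sν, ω) ≤ s⁻¹ · K(ν,ω)` for `0 < s ≤ 1` (i.e. `ν ↦ ν Â(ν)` is non-decreasing). -/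
theorem abelKernel_scale_le {s ν : ℝ} (hs : 0 < s) (hs1 : s ≤ 1) (hν : 0 < ν) (ω : ℝ) :
    abelKernel (s * ν) ω ≤ s⁻¹ * abelKernel ν ω := by
  unfold abelKernel
  have h1 : 0 < ν ^ 2 + ω ^ 2 := by positivity
  have h2 : 0 < (s * ν) ^ 2 + ω ^ 2 := by positivity
  rw [inv_mul_eq_div, div_div, div_le_div_iff₀ h2 (by positivity)]
  have hs2 : s ^ 2 ≤ 1 := by nlinarith
  nlinarith [sq_nonneg ν, sq_nonneg ω, mul_nonneg (mul_nonneg hs.le hν.le) (sq_nonneg ω),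
    mul_le_mul_of_nonneg_left hs2 (mul_nonneg (mul_nonneg hs.le hν.le) (sq_nonneg ω))]

/-- SHARPNESS of the factor `1/2` under frequency halving: on a Dirac mass at `ω` the ratio
`K(ν/2,ω)/K(ν,ω)` equals `(ν²+ω²)/(2(ν²/4+ω²))`, which tends to `1/2` as `ω → ∞`; recorded as the exact
cross-multiplied identity (both sides equal `ν/2`). -/
theorem abelKernel_half_ratio {ν : ℝ} (hν : 0 < ν) (ω : ℝ) :
    abelKernel (ν / 2) ω * (ν ^ 2 / 4 + ω ^ 2) = (1 / 2) * abelKernel ν ω * (ν ^ 2 + ω ^ 2) := by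
  unfold abelKernel
  have h1 : (ν ^ 2 + ω ^ 2) ≠ 0 := by positivity
  have h2 : ((ν / 2) ^ 2 + ω ^ 2) ≠ 0 := by positivity
  field_simp
  ring

/-- The measure-level consequence (no integrability needed, `lintegral` form): for every measure `σ` on
`ℝ`, `s · Â(ν) ≤ Â(sν)`.  With `s = 2^{-k}` this is the exact geometric loss with which a floor at one
certified frequency propagates towards `ν = 0`: it never yields `limsup_{ν↓0} Â(ν) > 0`. -/
theorem abelMean_scale_ge (σ : Measure ℝ) {s ν : ℝ} (hs : 0 < s) (hs1 : s ≤ 1) (hν : 0 < ν) :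
    ENNReal.ofReal s * ∫⁻ ω, ENNReal.ofReal (abelKernel ν ω) ∂σ ≤
      ∫⁻ ω, ENNReal.ofReal (abelKernel (s * ν) ω) ∂σ := by
  rw [← lintegral_const_mul' _ _ ENNReal.ofReal_ne_top]
  apply lintegral_mono
  intro ω
  dsimp only
  rw [← ENNReal.ofReal_mul hs.le]
  exact ENNReal.ofReal_le_ofReal (abelKernel_scale_ge hs hs1 hν ω)

/-! ## §2 The matched-scale weight estimate behind decomposition B-D1 -/

/-- The high-pass weight `x ↦ x/(ν² + x)` (`x = ω²`) is monotone: spectral weight at `ω² ≥ x₀` contributes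
to the Kubo function `∫ ν ω²/((ν²+ω²)k²) dS_ee(k,ω)` at least the fraction `x₀/(ν²+x₀)`. -/
theorem weightKernel_mono {ν x₀ x : ℝ} (hx₀ : 0 ≤ x₀) (h : x₀ ≤ x) :
    x₀ / (ν ^ 2 + x₀) ≤ x / (ν ^ 2 + x) := by
  rcases eq_or_lt_of_le (add_nonneg (sq_nonneg ν) hx₀) with h0 | h0
  · have hν : ν ^ 2 = 0 := by nlinarith [sq_nonneg ν]
    have hx0 : x₀ = 0 := by nlinarith [sq_nonneg ν]
    subst hx0
    simp only [add_zero, zero_div]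
    rcases eq_or_lt_of_le (le_trans hx₀ h) with hx | hx
    · simp [← hx]
    · rw [hν, zero_add, div_self hx.ne']; norm_num
  · rw [div_le_div_iff₀ h0 (by linarith)]
    nlinarith [sq_nonneg ν]

/-- On the diagonal `ν = η k²` the guaranteed fraction is exactly `1/2`: with a `θ`-fraction of the energy
structure factor above `|ω| ≥ ηk²`, the Kubo function is `≥ θ χ η /2` there — a floor on the DIAGONAL of the
`(k, ν)` plane, while the crux (`W⁻`) lives on the AXIS `k = 0⁺`. -/
theorem weightKernel_diag {ν : ℝ} (hν : 0 < ν) : ν ^ 2 / (ν ^ 2 + ν ^ 2) = 1 / 2 := by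
  have : ν ^ 2 ≠ 0 := by positivity
  field_simp
  ring

/-! ## §3 The engine a sign principle would unlock (strengthening B-S1) -/

/-- **Positive autocorrelation + short-time floor ⇒ Abel floor.**  If `C ≥ 0` a.e. on `(0,∞)`, `C ≥ c₀` on
`(0, t₀]` and `t ↦ e^{-νt} C t` is integrable on `(0,∞)`, then `∫_{(0,∞)} e^{-νt} C(t) dt ≥ c₀ t₀ e^{-ν t₀}`.
For the bulk current autocorrelation `C(0⁺) = Σ_x Cov(j₀, j_x) > 0` is a STATIC Gibbs quantity and the
short-time floor follows from a static second-moment bound, so under the sign hypothesis `C ≥ 0` the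
uniform Abel floor `W` would be immediate; the census records why no sign principle is available and the
numerical evidence on the sign (kit j027821). -/
theorem abelMean_ge_of_nonneg_of_floor {C : ℝ → ℝ} {ν c₀ t₀ : ℝ} (hν : 0 ≤ ν) (hc₀ : 0 ≤ c₀)
    (ht₀ : 0 < t₀)
    (hint : IntegrableOn (fun t => exp (-(ν * t)) * C t) (Ioi 0))
    (hpos : ∀ t, 0 < t → 0 ≤ C t) (hfloor : ∀ t, 0 < t → t ≤ t₀ → c₀ ≤ C t) :
    c₀ * t₀ * exp (-(ν * t₀)) ≤ ∫ t in Ioi (0 : ℝ), exp (-(ν * t)) * C t := by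
  have hsub : Ioc (0 : ℝ) t₀ ⊆ Ioi 0 := fun t ht => ht.1
  have hnn : ∀ t ∈ Ioi (0 : ℝ), 0 ≤ exp (-(ν * t)) * C t :=
    fun t ht => mul_nonneg (exp_pos _).le (hpos t ht)
  -- restrict to `(0, t₀]`
  have h1 : ∫ t in Ioc (0 : ℝ) t₀, exp (-(ν * t)) * C t ≤ ∫ t in Ioi (0 : ℝ), exp (-(ν * t)) * C t := by
    apply setIntegral_mono_set hint
    · exact (ae_restrict_iff' measurableSet_Ioi).mpr (Filter.Eventually.of_forall hnn)
    · exact hsub.eventuallyLE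
  -- bound the integrand below on `(0, t₀]` by the constant `c₀ e^{-ν t₀}`
  have h2 : ∫ t in Ioc (0 : ℝ) t₀, c₀ * exp (-(ν * t₀)) ≤ ∫ t in Ioc (0 : ℝ) t₀, exp (-(ν * t)) * C t := by
    apply setIntegral_mono_on ((continuous_const.integrableOn_Icc).mono_set Ioc_subset_Icc_self)
      (hint.mono_set hsub) measurableSet_Ioc
    intro t ht
    have hexp : exp (-(ν * t₀)) ≤ exp (-(ν * t)) := exp_le_exp.mpr (by nlinarith [ht.1, ht.2])
    calc c₀ * exp (-(ν * t₀)) ≤ c₀ * exp (-(ν * t)) := mul_le_mul_of_nonneg_left hexp hc₀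
      _ ≤ C t * exp (-(ν * t)) := mul_le_mul_of_nonneg_right (hfloor t ht.1 ht.2) (exp_pos _).le
      _ = exp (-(ν * t)) * C t := mul_comm _ _
  have h3 : ∫ t in Ioc (0 : ℝ) t₀, c₀ * exp (-(ν * t₀)) = c₀ * t₀ * exp (-(ν * t₀)) := by
    simp only [setIntegral_const, measureReal_def, Real.volume_Ioc, sub_zero, ENNReal.toReal_ofReal ht₀.le,
      smul_eq_mul]
    ring
  linarith

/-! ## §4 Boltzmann weight beats sub-quartic lifetimes (negation B-N1) -/

/-- Completing the square: `c A² − a A⁴ ≤ (c+1)²/(4a) − A²` for `a > 0`. -/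
theorem sq_sub_quartic_le {a c : ℝ} (ha : 0 < a) (A : ℝ) :
    c * A ^ 2 - a * A ^ 4 ≤ (c + 1) ^ 2 / (4 * a) - A ^ 2 := by
  have h4a : 0 < 4 * a := by positivity
  have key : 0 ≤ a * (A ^ 2 - (c + 1) / (2 * a)) ^ 2 := by positivity
  have expand : a * (A ^ 2 - (c + 1) / (2 * a)) ^ 2 = a * A ^ 4 - (c + 1) * A ^ 2 + (c + 1) ^ 2 / (4 * a) := by
    field_simp
    ring
  nlinarith [key, expand]

/-- **Finite mean blocker resistance.**  `∫ exp(c A² − a A⁴) dA < ∞` for every `a > 0` and every `c`: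
if a localised excitation of amplitude `A` blocks transport for a time `≲ e^{cA²}` (any sub-quartic
exponent) while its Gibbs probability is `≲ e^{-aA⁴}` (`a = lam/(4T)` for the quartic pinning), the mean
blocking time per site is finite — rare long-lived breathers in series cannot make the chain a perfect
insulator; an insulating Griffiths mechanism would need lifetimes growing faster than `exp(lam A⁴/4T)`. -/
theorem integrable_exp_sq_sub_quartic {a : ℝ} (ha : 0 < a) (c : ℝ) :
    Integrable (fun A : ℝ => exp (c * A ^ 2 - a * A ^ 4)) := by
  have hg : Integrable (fun A : ℝ => exp ((c + 1) ^ 2 / (4 * a)) * exp (-1 * A ^ 2)) :=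
    (integrable_exp_neg_mul_sq (by norm_num : (0 : ℝ) < 1)).const_mul _
  refine hg.mono' (by fun_prop) (Filter.Eventually.of_forall fun A => ?_)
  rw [Real.norm_eq_abs, abs_of_pos (exp_pos _), ← Real.exp_add]
  exact exp_le_exp.mpr (by have := sq_sub_quartic_le ha (c := c) A; linarith)

/-! ## §5 Exact temperature–anharmonicity scaling of the `pinnedChain` Hamiltonian (strengthening B-S2) -/

open Literature.MathematicalPhysics.KineticTheory.HeatConduction in
/-- **Scaling law, algebraic core, against the tree's definitions.**  For the actual
`pinnedChain ω₂ lam β γ` and `T ≥ 0`:  `H_{ω₂,lam,β}(√T q, √T p) = T · H_{ω₂, lam T, β T}(q, p)`.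
Together with the linearity of the Langevin terms this gives `D_N(T; ω₂,lam,β,γ) = D_N(1; ω₂,lamT,βT,γ)`
(the dimensionless conductance is constant on the rays `(lam T, β T) = const`), so the heuristic
`κ(T) → ∞` at both `T → 0` (kinetic regime) and `T → ∞` makes `D_N` NON-monotone in `(lam, β)` for large
`N`: the strengthening "anharmonicity only adds resistance" is false in the only form that would let one
compare with a solvable corner. [cite: AokiLukkarinenSpohn2006, §2] -/
theorem hamiltonian_pinnedChain_scaling (ω₂ lam β γ : ℝ) {T : ℝ} (hT : 0 ≤ T) (N : ℕ)
    (x : PhaseSpace N) :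
    (pinnedChain ω₂ lam β γ).hamiltonian N (fun i => Real.sqrt T * x.1 i, fun i => Real.sqrt T * x.2 i) =
      T * (pinnedChain ω₂ (lam * T) (β * T) γ).hamiltonian N x := by
  have h2 : Real.sqrt T ^ 2 = T := Real.sq_sqrt hT
  have h4 : Real.sqrt T ^ 4 = T ^ 2 := by
    calc Real.sqrt T ^ 4 = (Real.sqrt T ^ 2) ^ 2 := by ring
      _ = T ^ 2 := by rw [h2]
  simp only [OscillatorChain.hamiltonian, pinnedChain]
  rw [mul_add, Finset.mul_sum, Finset.mul_sum]
  congr 1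
  · refine Finset.sum_congr rfl fun i _ => ?_
    have e1 : (Real.sqrt T * x.2 i) ^ 2 = T * x.2 i ^ 2 := by rw [mul_pow, h2]
    have e2 : (Real.sqrt T * x.1 i) ^ 2 = T * x.1 i ^ 2 := by rw [mul_pow, h2]
    have e3 : (Real.sqrt T * x.1 i) ^ 4 = T ^ 2 * x.1 i ^ 4 := by rw [mul_pow, h4]
    rw [e1, e2, e3]
    ring
  · refine Finset.sum_congr rfl fun i _ => ?_
    rw [Finset.mul_sum]
    refine Finset.sum_congr rfl fun j _ => ?_
    split_ifs with hij
    · have e2 : (Real.sqrt T * x.1 j - Real.sqrt T * x.1 i) ^ 2 = T * (x.1 j - x.1 i) ^ 2 := by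
        rw [← mul_sub, mul_pow, h2]
      have e3 : (Real.sqrt T * x.1 j - Real.sqrt T * x.1 i) ^ 4 = T ^ 2 * (x.1 j - x.1 i) ^ 4 := by
        rw [← mul_sub, mul_pow, h4]
      rw [e2, e3]
      ring
    · simp

end Summit.AtomisticToContinuum.FouriersLaw.Cruxes.ConductanceLowerBound.StrategistS3B

end
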